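import Mathlib
import Summits.KontsevichZagierPeriods.KontsevichZagierPeriods.Theorems.SoloInformedWordEnds
import HarnessLib
import HarnessLib.Audit

/-!
# SoloInformed — block labellings of the cube and their representations

Solo programme `solo-KontsevichZagierPeriods-informed`, session s47 (PROGRAMME XLVI, file 4).

A BLOCK LABELLING of the coordinates of `(0,1)^{M+1}` is a map `β : Fin (M+1) → ℕ` with values
`0,…,k`, every label attained, and label `0` attained at least twice (`soloInformedIsLab β k`).
Its INDEX is the list of fibre sizes `idx(β) = (#β⁻¹0, …, #β⁻¹k)` (admissible of weight
`M+1`), and its CHAIN PRODUCTS are `Q_t(w) = ∏_{β(l) ≤ t} w_l`.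

Sorting the coordinates by label (`Tuple.sort β`, rule (2), `|det| = 1`) carries the cube
representation `CubeW idx(β)` of file 1 to the representation

  `BRep β = [ (0,1)^{M+1},  w ↦ G(Q_0(w), …, Q_k(w)) ]`,   `⟦BRep β⟧ = mzvClass idx(β)`

(`soloInformedBRep`, `soloInformed_bRep_integrand`, `soloInformed_bRep_class`).  The key
combinatorial step is the lower-set lemma `soloInformed_filter_sort_le`: after sorting, the
coordinates with label `≤ t` are exactly the first `#{β ≤ t}` ones, so the prefix products of
the sorted point are the chain products.  In file 5 the terms of the harmonic product are the
`BRep` of explicit labellings of the product cube.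

References: Kontsevich–Zagier 2001 §1.2 (rule (2)); Hoffman 1992 §2; Zagier 1994 §9.
-/

noncomputable section

open Literature.NumberTheory.Transcendental
open Literature.NumberTheory.Transcendental.KZ

namespace Summit.KontsevichZagierPeriods.KontsevichZagierPeriods.Theorems

/-! ## 1. Fibres, cumulative counts, chain products -/

section lab

variable {N : ℕ} (β : Fin N → ℕ)

/-- The size of the fibre `β⁻¹(t)`. -/
def soloInformedFib (t : ℕ) : ℕ := (Finset.univ.filter fun l : Fin N => β l = t).card

/-- The cumulative count `#{l | β l ≤ t}`. -/
def soloInformedCum (t : ℕ) : ℕ := (Finset.univ.filter fun l : Fin N => β l ≤ t).card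

/-- The chain product `Q_t(w) = ∏_{β l ≤ t} w_l`. -/
def soloInformedBP (w : Fin N → ℝ) (t : ℕ) : ℝ :=
  ∏ l ∈ Finset.univ.filter (fun l : Fin N => β l ≤ t), w l

/-- `cum 0 = fib 0`. -/
theorem soloInformed_cum_zero : soloInformedCum β 0 = soloInformedFib β 0 := by
  unfold soloInformedCum soloInformedFib
  congr 1
  ext l
  simp

/-- `cum (t+1) = cum t + fib (t+1)`. -/
theorem soloInformed_cum_succ (t : ℕ) :
    soloInformedCum β (t + 1) = soloInformedCum β t + soloInformedFib β (t + 1) := by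
  unfold soloInformedCum soloInformedFib
  rw [← Finset.card_union_of_disjoint (Finset.disjoint_filter.2 fun l _ h1 h2 => by omega),
    ← Finset.filter_or]
  congr 1
  ext l
  simp only [Finset.mem_filter, Finset.mem_univ, true_and]
  omega

/-- `fib t ≤ cum t`. -/
theorem soloInformed_fib_le_cum (t : ℕ) : soloInformedFib β t ≤ soloInformedCum β t := by
  unfold soloInformedCum soloInformedFib
  exact Finset.card_le_card fun l hl => by
    simp only [Finset.mem_filter, Finset.mem_univ, true_and] at hl ⊢
    omega

/-- `cum` is monotone. -/
theorem soloInformed_cum_mono {s t : ℕ} (h : s ≤ t) : soloInformedCum β s ≤ soloInformedCum β t := by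
  unfold soloInformedCum
  exact Finset.card_le_card fun l hl => by
    simp only [Finset.mem_filter, Finset.mem_univ, true_and] at hl ⊢
    omega

/-! ## 2. The index of a labelling -/

/-- The index `(fib 0, …, fib (K−1))` of a labelling with `K` blocks. -/
def soloInformedIdx (K : ℕ) : List ℕ := List.ofFn fun t : Fin K => soloInformedFib β t

/-- Length of the index. -/
@[simp] theorem soloInformed_length_idx (K : ℕ) : (soloInformedIdx β K).length = K := by
  simp [soloInformedIdx]

/-- Entries of the index. -/
theorem soloInformed_idx_getElem {K t : ℕ} (ht : t < (soloInformedIdx β K).length) :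
    (soloInformedIdx β K)[t] = soloInformedFib β t := by
  simp [soloInformedIdx]

/-- Partial sums of the index are the cumulative counts. -/
theorem soloInformed_sum_take_idx {K : ℕ} : ∀ r : ℕ, r < K →
    ((soloInformedIdx β K).take (r + 1)).sum = soloInformedCum β r
  | 0, h => by
    rw [List.sum_take_succ _ _ (by simpa using h), List.take_zero, List.sum_nil, zero_add,
      soloInformed_idx_getElem, soloInformed_cum_zero]
  | r + 1, h => by
    rw [List.sum_take_succ _ _ (by simpa using h), soloInformed_sum_take_idx r (by omega),
      soloInformed_idx_getElem, soloInformed_cum_succ]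

/-- **The block ends of the index are the cumulative counts.** -/
theorem soloInformed_ends_idx {K r : ℕ} (hr : r < K) :
    (soloInformedEnds (soloInformedIdx β K)).getD r 0 = soloInformedCum β r := by
  rw [soloInformed_ends_getD (by simpa using hr), soloInformed_sum_take_idx β r hr]

/-! ## 3. Valid labellings -/

/-- A valid block labelling with blocks `0,…,k`: labels `≤ k`, every block nonempty, block `0`
of size `≥ 2`. -/
def soloInformedIsLab (k : ℕ) : Prop :=
  (∀ l, β l ≤ k) ∧ (∀ t ≤ k, 1 ≤ soloInformedFib β t) ∧ 2 ≤ soloInformedFib β 0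

variable {β} {k : ℕ} (hL : soloInformedIsLab β k)
include hL

/-- Entries of the index are positive. -/
theorem soloInformed_idx_pos : ∀ i ∈ soloInformedIdx β (k + 1), 1 ≤ i := by
  intro i hi
  rw [soloInformedIdx, List.mem_ofFn] at hi
  obtain ⟨t, rfl⟩ := hi
  exact hL.2.1 t (by omega)

/-- The index is admissible. -/
theorem soloInformed_idx_isAdmissible : MZV.IsAdmissible (soloInformedIdx β (k + 1)) := by
  refine ⟨soloInformed_idx_pos hL, fun _ => ?_⟩
  simp only [soloInformedIdx, List.ofFn_succ, List.head_cons, Fin.val_zero]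
  exact hL.2.2

/-- The top cumulative count is everything. -/
theorem soloInformed_cum_top : soloInformedCum β k = N := by
  unfold soloInformedCum
  rw [Finset.filter_true_of_mem fun l _ => hL.1 l, Finset.card_univ, Fintype.card_fin]

/-- The index has weight `N`. -/
theorem soloInformed_idx_sum : (soloInformedIdx β (k + 1)).sum = N := by
  have h := soloInformed_sum_take_idx β k (Nat.lt_succ_self k)
  rw [List.take_of_length_le (by simp)] at h
  rw [h]
  exact soloInformed_cum_top hL

/-- The index has weight `N` (`MZV.weight` form). -/
theorem soloInformed_idx_weight : MZV.weight (soloInformedIdx β (k + 1)) = N :=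
  soloInformed_idx_sum hL

/-- Every cumulative count is positive. -/
theorem soloInformed_one_le_cum (t : ℕ) : 1 ≤ soloInformedCum β t :=
  (hL.2.2.trans (soloInformed_fib_le_cum β 0)).trans (soloInformed_cum_mono β (Nat.zero_le t)) |>.trans' 
    (by norm_num)

end lab

/-! ## 4. Sorting by label: the lower-set lemma -/

section sort

variable {N : ℕ} (β : Fin N → ℕ)

/-- **After sorting by label, the coordinates with label `≤ t` are the first `#{β ≤ t}`.** -/
theorem soloInformed_filter_sort_le (t : ℕ) :
    Finset.univ.filter (fun l : Fin N => β (Tuple.sort β l) ≤ t) =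
      Finset.univ.filter (fun l : Fin N => l.1 < soloInformedCum β t) := by
  set σ := Tuple.sort β with hσ
  set A := Finset.univ.filter (fun l : Fin N => β (σ l) ≤ t) with hA
  have hmono : Monotone (β ∘ σ) := Tuple.monotone_sort β
  have hcard : A.card = soloInformedCum β t := by
    unfold soloInformedCum
    rw [← Finset.card_map σ.toEmbedding]
    congr 1
    ext l
    simp only [Finset.mem_map_equiv, hA, Finset.mem_filter, Finset.mem_univ, true_and,
      Equiv.apply_symm_apply]
  have hlow : ∀ l ∈ A, ∀ l' ≤ l, l' ∈ A := fun l hl l' hl' => by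
    simp only [hA, Finset.mem_filter, Finset.mem_univ, true_and] at hl ⊢
    exact (hmono hl').trans hl
  have hsub : A ⊆ Finset.univ.filter (fun l : Fin N => l.1 < A.card) := fun l hl => by
    simp only [Finset.mem_filter, Finset.mem_univ, true_and]
    have h1 : Finset.Iic l ⊆ A := fun l' hl' => hlow l hl l' (Finset.mem_Iic.1 hl')
    have h2 := Finset.card_le_card h1
    rw [Fin.card_Iic] at h2
    omega
  rw [← hcard]
  refine Finset.eq_of_subset_of_card_le hsub ?_
  calc (Finset.univ.filter (fun l : Fin N => l.1 < A.card)).card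
      ≤ (Finset.range A.card).card :=
        Finset.card_le_card_of_injOn (fun l => l.1) (fun l hl => by
          simp only [Finset.coe_filter, Finset.mem_univ, true_and, Set.mem_setOf_eq] at hl
          simpa using hl) (fun a _ b _ h => Fin.ext h)
    _ = A.card := Finset.card_range _

/-- **Prefix products of the sorted point are the chain products.** -/
theorem soloInformed_PP_sort {M : ℕ} (β : Fin (M + 1) → ℕ) (w : Fin (M + 1) → ℝ) {t : ℕ}
    (ht : 1 ≤ soloInformedCum β t) :
    soloInformedPP (fun l => w (Tuple.sort β l)) (soloInformedCum β t - 1) = soloInformedBP β w t := by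
  unfold soloInformedPP soloInformedBP
  have hset : Finset.univ.filter (fun i : Fin (M + 1) => i.1 ≤ soloInformedCum β t - 1) =
      Finset.univ.filter (fun l : Fin (M + 1) => β (Tuple.sort β l) ≤ t) := by
    rw [soloInformed_filter_sort_le]
    ext i
    simp only [Finset.mem_filter, Finset.mem_univ, true_and]
    omega
  rw [hset]
  exact Finset.prod_equiv (Tuple.sort β) (fun i => by simp) (fun i _ => rfl)

end sort

/-! ## 5. The representation of a labelling -/

section rep

variable {M k : ℕ} (β : Fin (M + 1) → ℕ) (hL : soloInformedIsLab β k)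

/-- `BRep β = σ_β · CubeW idx(β)`: the cube representation of the index, coordinates sorted by
label (rule (2)). -/
def soloInformedBRep : IntegralRep (M + 1) :=
  (soloInformedCubeW (soloInformedIdx β (k + 1)) (soloInformed_idx_isAdmissible hL)
    (soloInformed_idx_weight hL)).reindex (Tuple.sort β)

/-- The domain of `BRep β` is the cube. -/
@[simp] theorem soloInformed_bRep_domain :
    (soloInformedBRep β hL).domain = soloInformedOpenCube (M + 1) := by
  ext w
  change (fun i => w (Tuple.sort β i)) ∈ soloInformedOpenCube (M + 1) ↔
    w ∈ soloInformedOpenCube (M + 1)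
  exact ⟨fun h j => by simpa using h ((Tuple.sort β).symm j), fun h i => h _⟩

/-- **The integrand of `BRep β` is `G(Q_0(w), …, Q_k(w))`.** -/
theorem soloInformed_bRep_integrand (w : Fin (M + 1) → ℝ) :
    (soloInformedBRep β hL).integrand w =
      soloInformedGQ (List.ofFn fun t : Fin (k + 1) => soloInformedBP β w t) := by
  change soloInformedCubeWf (soloInformedWordFn (soloInformedIdx β (k + 1)) M)
    (fun i => w (Tuple.sort β i)) = _
  rw [soloInformed_cubeWf_eq_GQ (soloInformed_idx_pos hL) (soloInformed_idx_sum hL)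
    (soloInformed_length_idx β (k + 1))]
  congr 1
  refine List.ofFn_inj.2 (funext fun t => ?_)
  rw [soloInformed_ends_idx β t.2, soloInformed_PP_sort β w (soloInformed_one_le_cum hL t)]

/-- **`⟦BRep β⟧ = mzvClass idx(β)`** (rule (2) for the sorting permutation, then file 1). -/
theorem soloInformed_bRep_class :
    toFormalPeriod (of (soloInformedBRep β hL)) = mzvClass (soloInformedIdx β (k + 1)) := by
  rw [← soloInformed_cubeW_class (soloInformedIdx β (k + 1)) (soloInformed_idx_isAdmissible hL)
    (soloInformed_idx_weight hL), eq_comm, toFormalPeriod_eq_iff]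
  exact of_sub_of_reindex_mem_relations _ _

include hL in
/-- The chain products lie in `(0,1)` on the cube. -/
theorem soloInformed_BP_mem_Ioo {w : Fin (M + 1) → ℝ} (hw : w ∈ soloInformedOpenCube (M + 1))
    (t : ℕ) : 0 < soloInformedBP β w t ∧ soloInformedBP β w t < 1 := by
  rw [← soloInformed_PP_sort β w (soloInformed_one_le_cum hL t)]
  exact soloInformedPP_mem_Ioo (x := fun l => w (Tuple.sort β l)) (fun j => hw _) _

end rep

end Summit.KontsevichZagierPeriods.KontsevichZagierPeriods.Theorems
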